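import Mathlib
import Summits.PneNP.PneNP.Theorems.RamseyUncertifiableResolutionUncertaintyTreeLikeUncertainty
import Summits.PneNP.PneNP.Theorems.RamseyUncertifiableRamseyAbundant
import Literature.Computability.MetaComplexity.Resolution

/-!
# Witness (F3 / BC5) for line `ladder-dag-resolution` of crux `RamseyNotNP` (stmt-PneNP-9814)

The rung schema `ResRung R` specialised to the PROVED floor `R = IsTreeLike`: tree-like resolution refutation
pairs of the clique formulas of a Ramsey graph and its complement are io-superpolynomial — from the landed
`treeLike_uncertainty` (every graph, `n ≥ 2^22`, `n^{(log₂ n)/9} ≤ max`) and `ramseyAbundant_proof` (Erdős 1947: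
Ramsey graphs exist at every `n ≥ 3`).  NO sorry.  (The definition of `ResRung` is repeated verbatim from the
skeleton `Lines/ladder-dag-resolution.lean` so that this file elaborates on its own.)
-/

set_option linter.dupNamespace false

namespace Summit.PneNP.PneNP.Cruxes.RamseyNotNP.LadderDagResolution.Special

open Literature.Computability.Complexity Literature.Computability.MetaComplexity
open Summit.PneNP.PneNP.Theses.RamseyUncertifiable (RamseyAbundant)
open Summit.PneNP.PneNP.Theorems (ramseyAbundant_proof)
open Summit.PneNP.PneNP.Theorems.RegularResolutionRung.Negative (cliqueCNF)
open Summit.PneNP.PneNP.Theorems.RamseyUncertifiableResolutionUncertainty (treeLike_uncertainty)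

/-- Verbatim copy of `LadderDagResolution.ResRung`. -/
def ResRung (R : List (ResLine ℕ) → Prop) : Prop :=
  ∀ c n₀ : ℕ, ∃ n, n₀ ≤ n ∧ ∃ G : SimpleGraph (Fin n),
    G.CliqueFree (Nat.clog 2 (n ^ 2)) ∧ Gᶜ.CliqueFree (Nat.clog 2 (n ^ 2)) ∧
    ∀ [DecidableRel G.Adj], ∀ π₁ π₂ : List (ResLine ℕ),
      IsResRefutation (cliqueCNF n (Nat.clog 2 (n ^ 2)) fun u v => decide (G.Adj u v)) π₁ →
      IsResRefutation (cliqueCNF n (Nat.clog 2 (n ^ 2)) fun u v => decide (Gᶜ.Adj u v)) π₂ →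
      R π₁ → R π₂ → n ^ c < max π₁.length π₂.length

/-- The floor at a given `n ≥ 2^{9c+22}`: some Ramsey graph on `n` vertices whose tree-like refutation pairs all
exceed `n^c` (from `treeLike_uncertainty`, which holds for EVERY graph, and `ramseyAbundant_proof`). -/
theorem resRung_treeLike_at {c n : ℕ} (hpow : 2 ^ (9 * c + 22) ≤ n) :
    ∃ G : SimpleGraph (Fin n),
      G.CliqueFree (Nat.clog 2 (n ^ 2)) ∧ Gᶜ.CliqueFree (Nat.clog 2 (n ^ 2)) ∧
      ∀ [DecidableRel G.Adj], ∀ π₁ π₂ : List (ResLine ℕ),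
        IsResRefutation (cliqueCNF n (Nat.clog 2 (n ^ 2)) fun u v => decide (G.Adj u v)) π₁ →
        IsResRefutation (cliqueCNF n (Nat.clog 2 (n ^ 2)) fun u v => decide (Gᶜ.Adj u v)) π₂ →
        IsTreeLike π₁ → IsTreeLike π₂ → n ^ c < max π₁.length π₂.length := by
  have h22 : 2 ^ 22 ≤ n := le_trans (Nat.pow_le_pow_right (by norm_num) (by omega)) hpow
  have hn3 : 3 ≤ n := le_trans (by norm_num) h22
  obtain ⟨G, hG, hGc⟩ := ramseyAbundant_proof n hn3
  refine ⟨G, hG, hGc, ?_⟩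
  intro _ π₁ π₂ h₁ h₂ ht₁ ht₂
  have key := treeLike_uncertainty n h22 G (Nat.clog 2 (n ^ 2)) (Nat.clog 2 (n ^ 2)) π₁ π₂ h₁ ht₁ h₂ ht₂
  have hn1 : (1 : ℝ) < n := by exact_mod_cast lt_of_lt_of_le (by norm_num) hn3
  have hnpos : (0 : ℝ) < n := by linarith
  have hlog : ((9 * c + 22 : ℕ) : ℝ) ≤ Real.logb 2 n := by
    rw [Real.le_logb_iff_rpow_le (by norm_num) hnpos, Real.rpow_natCast]
    exact_mod_cast hpow
  have hc : (c : ℝ) < Real.logb 2 n / 9 := by push_cast at hlog; linarith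
  have hlt : (n : ℝ) ^ (c : ℝ) < (n : ℝ) ^ (Real.logb 2 n / 9) :=
    Real.rpow_lt_rpow_of_exponent_lt hn1 hc
  have e1 : ((n ^ c : ℕ) : ℝ) = (n : ℝ) ^ (c : ℝ) := by rw [Nat.cast_pow, Real.rpow_natCast]
  have e2 : ((max π₁.length π₂.length : ℕ) : ℝ) = max (π₁.length : ℝ) (π₂.length : ℝ) := Nat.cast_max _ _
  have : ((n ^ c : ℕ) : ℝ) < ((max π₁.length π₂.length : ℕ) : ℝ) := by
    rw [e1, e2]; exact hlt.trans_le key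
  exact_mod_cast this

/-- **The floor rung, proved**: `ResRung IsTreeLike`. -/
theorem resRung_treeLike : ResRung IsTreeLike := fun c n₀ =>
  ⟨max n₀ (2 ^ (9 * c + 22)), le_max_left _ _, resRung_treeLike_at (le_max_right _ _)⟩

/-- F3 witness in the required shape. -/
example : ResRung IsTreeLike := resRung_treeLike

end Summit.PneNP.PneNP.Cruxes.RamseyNotNP.LadderDagResolution.Special
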